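import Summits.NavierStokesRegularity.OSWSelfSimilar.SheetNSLineSchochetTwoPoleBlowup
import HarnessLib

/-!
# The Schochet–ALSS blow-up is a ONE-POINT blow-up at the origin, driven by the stretching rate `u_x(0,t) = H[ω(t,·)](0)`

HONEST FRAMING (cell ns-blowup GROUP B «PROFILE SEARCH», zone Z3, rows Z3-U (A-F2) / Z3-E12⁻ (clause (i′)) of
`HOME/profile/z3/CENSUS-Z3.md`; human rulings D-0035/D-0074): **1-D MODEL (viscous CLM `ω_t = ω·Hω + ν ω_xx` on `ℝ`, genuine
`hilbertTransform`); not Euler, not Navier–Stokes; «violates: none — MODEL».**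

CONTENT (solution family of `SheetNSLineSchochetTwoPoleSolution.lean`, blow-up time `T = (σ² − s₀²)/(40kν)`):
* `hilbertTransform_solution_zero_ge` — the stretching rate at the origin `u_x(0,t) = H[ω(t,·)](0) = (24kν/s)(1/y₁ − 1/y₂) + 12ν(1/y₁² + 1/y₂²)
  ≥ 12ν/y(t)²`; `tendsto_hilbertTransform_solution_zero` — it tends to `+∞` as `t ↑ T`; `hilbertTransform_solution_zero_rate` — at the
  rate `≥ 3σ²/(100k²ν)·(T−t)^{−2}`; **`not_intervalIntegrable_hilbertTransform_solution_zero` — `∫₀^T u_x(0,t) dt = +∞`** (not interval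
  integrable on `[0,T]`): the one-point blow-up criterion of Chen 2020 (Thm 1.3, class 3, slightly subcritical dissipation) is met here
  with full viscosity [Chen 2020 is context, not used];
* `solution_abs_le_away_from_zero` — away from the origin the solution stays bounded up to `T`: `|ω(t,x)| ≤ 24(k+1)ν/x²` for all
  `0 ≤ t < T`, `x ≠ 0` — the blow-up set is `{0}`.
[cite: AmbroseLushnikovSiegelSilantyev2024, §5.1.1 (blow-up at `x = 0`, `t = t_c`)]. WHAT IS NOT HERE: anything about Navier–Stokes.
No definitions, no named facts. bears_on: LADDER-NS N5 / zone Z3 → N1 linear core.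
-/

noncomputable section

namespace Summit.NavierStokesRegularity.OSWSelfSimilar
namespace SheetNSLineSchochetTwoPole

open _root_.MeasureTheory Set Filter Literature.Analysis.Fourier
open scoped Real Topology

section Point

variable {ν k σ s₀ : ℝ} {s y : ℝ → ℝ} {ω : ℝ → ℝ → ℝ}

/-- **Stretching rate at the origin:** `H[ω(t,·)](0) = (24kν/s)(1/y − 1/(y+s)) + 12ν(1/y² + 1/(y+s)²) ≥ 12ν/y²`. [folklore] -/
theorem hilbertTransform_solution_zero_ge (hν : 0 < ν) (hk0 : 0 < k)
    (hω : ∀ t x, ω t x = (-24 * k * ν / s t) * (x / (x ^ 2 + y t ^ 2) - x / (x ^ 2 + (y t + s t) ^ 2))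
      + (-12 * ν) * (2 * y t * x / (x ^ 2 + y t ^ 2) ^ 2 + 2 * (y t + s t) * x / (x ^ 2 + (y t + s t) ^ 2) ^ 2))
    {t : ℝ} (hyt : 0 < y t) (hst : 0 < s t) :
    hilbertTransform (ω t) 0 = 24 * k * ν / s t * (1 / y t - 1 / (y t + s t)) + 12 * ν * (1 / y t ^ 2 + 1 / (y t + s t) ^ 2) ∧
      12 * ν / y t ^ 2 ≤ hilbertTransform (ω t) 0 := by
  have hy2 : 0 < y t + s t := by linarith
  have hyne : y t ≠ 0 := hyt.ne'
  have hy2ne : y t + s t ≠ 0 := hy2.ne'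
  have hsne : s t ≠ 0 := hst.ne'
  have e : hilbertTransform (ω t) 0
      = 24 * k * ν / s t * (1 / y t - 1 / (y t + s t)) + 12 * ν * (1 / y t ^ 2 + 1 / (y t + s t) ^ 2) := by
    rw [hilbertTransform_solution hω hyt hst 0]
    field_simp
    ring
  refine ⟨e, ?_⟩
  rw [e]
  have h1 : 0 ≤ 1 / y t - 1 / (y t + s t) := sub_nonneg.2 (one_div_le_one_div_of_le hyt (by linarith))
  have h2 : 0 ≤ 24 * k * ν / s t * (1 / y t - 1 / (y t + s t)) := mul_nonneg (by positivity) h1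
  have h3 : 0 ≤ 1 / (y t + s t) ^ 2 := by positivity
  have e2 : 12 * ν / y t ^ 2 = 12 * ν * (1 / y t ^ 2) := by ring
  rw [e2]
  nlinarith

/-- **The stretching rate at the origin diverges:** `H[ω(t,·)](0) → +∞` as `t ↑ T`. [folklore] -/
theorem tendsto_hilbertTransform_solution_zero (hν : 0 < ν) (hk0 : 0 < k) (hs₀ : 0 < s₀) (hs₀σ : s₀ < σ)
    (hs : ∀ t, s t = Real.sqrt (s₀ ^ 2 + 40 * k * ν * t)) (hy : ∀ t, y t = (σ - s t) / 2)
    (hω : ∀ t x, ω t x = (-24 * k * ν / s t) * (x / (x ^ 2 + y t ^ 2) - x / (x ^ 2 + (y t + s t) ^ 2))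
      + (-12 * ν) * (2 * y t * x / (x ^ 2 + y t ^ 2) ^ 2 + 2 * (y t + s t) * x / (x ^ 2 + (y t + s t) ^ 2) ^ 2)) :
    Tendsto (fun t => hilbertTransform (ω t) 0) (𝓝[<] ((σ ^ 2 - s₀ ^ 2) / (40 * k * ν))) atTop := by
  have hσ : 0 < σ := hs₀.trans hs₀σ
  have hT : 0 < (σ ^ 2 - s₀ ^ 2) / (40 * k * ν) := blowupTime_pos hν hk0 hs₀ hs₀σ
  have hup := tendsto_inv_depth_pow hν hk0 hσ hs hy (n := 2) (by norm_num) (by positivity : (0:ℝ) < 12 * ν)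
  refine tendsto_atTop_mono' _ ?_ hup
  have hpos : ∀ᶠ t in 𝓝[<] ((σ ^ 2 - s₀ ^ 2) / (40 * k * ν)), 0 < t := (lt_mem_nhds hT).filter_mono nhdsWithin_le_nhds
  filter_upwards [hpos, self_mem_nhdsWithin] with t ht0 htT
  exact (hilbertTransform_solution_zero_ge hν hk0 hω (depth_pos hν hk0 hσ hs hy htT)
    (sep_pos hs (radicand_pos hν hk0 hs₀ ht0.le))).2

/-- **Non-integrable rate:** `H[ω(t,·)](0) ≥ 3σ²/(100k²ν) · (T − t)^{−2}` on `0 ≤ t < T`. [folklore] -/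
theorem hilbertTransform_solution_zero_rate (hν : 0 < ν) (hk0 : 0 < k) (hs₀ : 0 < s₀) (hs₀σ : s₀ < σ)
    (hs : ∀ t, s t = Real.sqrt (s₀ ^ 2 + 40 * k * ν * t)) (hy : ∀ t, y t = (σ - s t) / 2)
    (hω : ∀ t x, ω t x = (-24 * k * ν / s t) * (x / (x ^ 2 + y t ^ 2) - x / (x ^ 2 + (y t + s t) ^ 2))
      + (-12 * ν) * (2 * y t * x / (x ^ 2 + y t ^ 2) ^ 2 + 2 * (y t + s t) * x / (x ^ 2 + (y t + s t) ^ 2) ^ 2))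
    {t : ℝ} (ht0 : 0 ≤ t) (htT : t < (σ ^ 2 - s₀ ^ 2) / (40 * k * ν)) :
    3 * σ ^ 2 / (100 * k ^ 2 * ν) / ((σ ^ 2 - s₀ ^ 2) / (40 * k * ν) - t) ^ 2 ≤ hilbertTransform (ω t) 0 := by
  have hσ : 0 < σ := hs₀.trans hs₀σ
  have hyt : 0 < y t := depth_pos hν hk0 hσ hs hy htT
  have hst : 0 < s t := sep_pos hs (radicand_pos hν hk0 hs₀ ht0)
  have hTt : 0 < (σ ^ 2 - s₀ ^ 2) / (40 * k * ν) - t := by linarith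
  obtain ⟨-, hup⟩ := depth_two_sided hν hk0 hs₀ hs₀σ hs hy ht0 htT.le
  have h := (hilbertTransform_solution_zero_ge hν hk0 hω hyt hst).2
  refine le_trans ?_ h
  have e : 3 * σ ^ 2 / (100 * k ^ 2 * ν) / ((σ ^ 2 - s₀ ^ 2) / (40 * k * ν) - t) ^ 2
      = 12 * ν / (20 * k * ν * ((σ ^ 2 - s₀ ^ 2) / (40 * k * ν) - t) / σ) ^ 2 := by
    field_simp
    ring
  rw [e]
  apply div_le_div_of_nonneg_left (by positivity) (by positivity)
  exact pow_le_pow_left₀ hyt.le hup 2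

/-- **Bounded away from the origin:** `|ω(t,x)| ≤ 24(k+1)ν/x²` for every `x ≠ 0` and every `t` with `y(t), s(t) > 0` — the blow-up set is `{0}`.
[folklore] -/
theorem solution_abs_le_away_from_zero (hν : 0 < ν) (hk0 : 0 < k)
    (hω : ∀ t x, ω t x = (-24 * k * ν / s t) * (x / (x ^ 2 + y t ^ 2) - x / (x ^ 2 + (y t + s t) ^ 2))
      + (-12 * ν) * (2 * y t * x / (x ^ 2 + y t ^ 2) ^ 2 + 2 * (y t + s t) * x / (x ^ 2 + (y t + s t) ^ 2) ^ 2))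
    {t : ℝ} (hyt : 0 < y t) (hst : 0 < s t) {x : ℝ} (hx : x ≠ 0) : |ω t x| ≤ 24 * (k + 1) * ν / x ^ 2 := by
  have h := solution_abs_le_lorentzian hν hk0 hω hyt hst x
  have hx2 : 0 < x ^ 2 := by positivity
  refine h.trans ?_
  rw [div_eq_mul_inv]
  apply mul_le_mul_of_nonneg_left _ (by positivity)
  exact inv_anti₀ hx2 (by nlinarith [sq_nonneg (y t)])

/-- **Chen's one-point blow-up criterion is met (kernel):** the stretching rate at the origin is NOT integrable up to `T`,
`¬ IntervalIntegrable (t ↦ H[ω(t,·)](0)) 0 T` — it dominates `c·(T−t)^{−2}`, whose primitive `(T−t)^{−1}` is unbounded.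
[folklore; cf. Chen 2020 Thm 1.3 (class 3: blow-up iff `∫₀^T u_x(0,t) dt = +∞`)] -/
theorem not_intervalIntegrable_hilbertTransform_solution_zero (hν : 0 < ν) (hk0 : 0 < k) (hs₀ : 0 < s₀) (hs₀σ : s₀ < σ)
    (hs : ∀ t, s t = Real.sqrt (s₀ ^ 2 + 40 * k * ν * t)) (hy : ∀ t, y t = (σ - s t) / 2)
    (hω : ∀ t x, ω t x = (-24 * k * ν / s t) * (x / (x ^ 2 + y t ^ 2) - x / (x ^ 2 + (y t + s t) ^ 2))
      + (-12 * ν) * (2 * y t * x / (x ^ 2 + y t ^ 2) ^ 2 + 2 * (y t + s t) * x / (x ^ 2 + (y t + s t) ^ 2) ^ 2)) :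
    ¬ IntervalIntegrable (fun t => hilbertTransform (ω t) 0) volume 0 ((σ ^ 2 - s₀ ^ 2) / (40 * k * ν)) := by
  have hσ : 0 < σ := hs₀.trans hs₀σ
  set T := (σ ^ 2 - s₀ ^ 2) / (40 * k * ν) with hT
  have hT0 : 0 < T := blowupTime_pos hν hk0 hs₀ hs₀σ
  have hTmem : T ∈ uIcc (0:ℝ) T := by simp [hT0.le]
  -- the left filter at `T` inside `[0, T]`
  have hsub : uIcc (0:ℝ) T \ {T} ⊆ {T}ᶜ := fun x hx => hx.2
  have hle : 𝓝[uIcc (0:ℝ) T \ {T}] T ≤ 𝓝[≠] T := nhdsWithin_mono _ hsub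
  -- `f(t) = (T − t)⁻¹`
  have hderiv : ∀ t, t ≠ T → HasDerivAt (fun t : ℝ => (T - t)⁻¹) (1 / (T - t) ^ 2) t := by
    intro t ht
    have hne : T - t ≠ 0 := sub_ne_zero.2 (Ne.symm ht)
    have h := ((hasDerivAt_const t T).sub (hasDerivAt_id t)).inv hne
    refine h.congr_deriv ?_
    norm_num
  refine not_intervalIntegrable_of_tendsto_norm_atTop_of_deriv_isBigO_within_sdiff_singleton
    (f := fun t : ℝ => (T - t)⁻¹) hT0.ne hTmem ?_ ?_ ?_
  · filter_upwards [self_mem_nhdsWithin] with t ht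
    exact (hderiv t ht.2).differentiableAt
  · -- `|T − t|⁻¹ → ∞`
    have h1 : Tendsto (fun t : ℝ => |T - t|) (𝓝[≠] T) (𝓝[>] 0) := by
      refine tendsto_nhdsWithin_iff.2 ⟨?_, ?_⟩
      · have : Tendsto (fun t : ℝ => |T - t|) (𝓝 T) (𝓝 |T - T|) :=
          ((continuous_const.sub continuous_id).abs).tendsto T
        rw [sub_self, abs_zero] at this
        exact this.mono_left nhdsWithin_le_nhds
      · filter_upwards [self_mem_nhdsWithin] with t ht
        exact abs_pos.2 (sub_ne_zero.2 (Ne.symm ht))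
    have h2 := (tendsto_inv_nhdsGT_zero.comp h1).mono_left hle
    refine h2.congr fun t => ?_
    simp [Real.norm_eq_abs]
  · -- `deriv f = (T−t)^{-2} = O(H[ω](0))` from the left
    refine Asymptotics.IsBigO.of_bound (100 * k ^ 2 * ν / (3 * σ ^ 2)) ?_
    have hmem : uIcc (0:ℝ) T \ {T} ∈ 𝓝[uIcc (0:ℝ) T \ {T}] T := self_mem_nhdsWithin
    filter_upwards [hmem] with t ht
    have ht' : t ∈ Icc (0:ℝ) T := by simpa [uIcc_of_le hT0.le] using ht.1
    have htT : t < T := lt_of_le_of_ne ht'.2 ht.2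
    have hrate := hilbertTransform_solution_zero_rate hν hk0 hs₀ hs₀σ hs hy hω ht'.1 htT
    have hpos : 0 < hilbertTransform (ω t) 0 := lt_of_lt_of_le (by positivity) hrate
    rw [(hderiv t htT.ne).deriv, Real.norm_eq_abs, Real.norm_eq_abs, abs_of_pos hpos,
      abs_of_pos (by positivity : (0:ℝ) < 1 / (T - t) ^ 2)]
    have hTt : 0 < T - t := by linarith
    have e : 100 * k ^ 2 * ν / (3 * σ ^ 2) * (3 * σ ^ 2 / (100 * k ^ 2 * ν) / (T - t) ^ 2) = 1 / (T - t) ^ 2 := by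
      field_simp
    calc 1 / (T - t) ^ 2 = 100 * k ^ 2 * ν / (3 * σ ^ 2) * (3 * σ ^ 2 / (100 * k ^ 2 * ν) / (T - t) ^ 2) := e.symm
      _ ≤ 100 * k ^ 2 * ν / (3 * σ ^ 2) * hilbertTransform (ω t) 0 :=
          mul_le_mul_of_nonneg_left hrate (by positivity)

end Point

end SheetNSLineSchochetTwoPole
end Summit.NavierStokesRegularity.OSWSelfSimilar

end
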